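import Mathlib
import Summits.ValiantsHypothesis.ValiantsHypothesis.Theorems.NewtonUnitEquationsTwoProductsFormalLogLinearisationLogSumEngineOne
import Summits.ValiantsHypothesis.ValiantsHypothesis.Theorems.NewtonUnitEquationsTwoProductsFormalLogLinearisationEngineCommonConeRung
import Summits.ValiantsHypothesis.ValiantsHypothesis.Theorems.TwoProducts.Negative.CommonPadding
import Summits.ValiantsHypothesis.ValiantsHypothesis.Theorems.TwoProducts.Negative.Dilation
import Summits.ValiantsHypothesis.ValiantsHypothesis.Theorems.TwoProducts.Negative.ShallowPadding
import HarnessLib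

/-!
# NEGATIVE lane (val-neg-1 g5): the CAP-THRESHOLD residual `HugeCapCellLaw` is `PlanarCellBound` (idea-34 K3 in kernel form)

Helper file for crux `stmt-ValiantsHypothesis-5906` (filed `--supports`; closes NO item, proves NO summit statement, does NOT prove
`TwoProducts`, `PlanarCellBound`, `CellLaw`, `HugeCapCellLaw`, any `ResidualLawV…` or VP ≠ VNP; 0 `def`s).

`hugeCap_padding`: every cell family `S ≠ ∅` of a normalised `t`-sparse pair `(u, v)` on `m` positions is transported (dilation `X ↦ X^N`,
then `g = 3(m + 4(Lg+1))` common digit positions, `t + 2 < 2^{Lg+1}`) to a cell family of the same cardinality of a normalised `t`-sparse pair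
on `m + g` positions whose CAP — tuple-sum points outside the log-support strictly above the supporting line of a visible point, the quantity of
val-idea-34's `HugeCapCellLaw` (text verbatim from `Cruxes/TwoProducts/ValIdea34GaugeSketch.lean`) — exceeds `2^{m+g}(t+2)^4`.
`planarCellBound_of_hugeCap`, `hugeCap_iff_planarCellBound`: hence the cap-threshold sub-law is the full per-cell law `PlanarCellBound`
(exponents `(a, b) ↦ (4a, b + 24a)`).  The card `Ideas/factor-gauge-rigidity.md` (K3) withdrew this axis on paper; this is the kernel record,
with ONE ray and no cell refinement.  [folklore]
-/

namespace Summit.ValiantsHypothesis.Theorems.TwoProducts.Negative.HugeCapResidual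

open Finset MvPolynomial
open Summit.ValiantsHypothesis.ValiantsHypothesis.Theorems.NewtonUnitEquations.TwoProducts.FormalLogLinearisation
open Summit.ValiantsHypothesis.ValiantsHypothesis.Theorems.NewtonUnitEquations.TwoProducts.PlanarCell
open Summit.ValiantsHypothesis.Theorems.TwoProducts.Negative.CommonPadding
open Summit.ValiantsHypothesis.Theorems.TwoProducts.Negative.Dilation
open Summit.ValiantsHypothesis.Theorems.TwoProducts.Negative.ShallowPadding

variable {m : ℕ}

/-- Points of the log-support have negative weight for every valid weight. [folklore] -/
theorem wt_neg_of_mem_logSupport {u v : Fin m → MvPolynomial (Fin 2) ℂ} {ξ : Fin 2 → ℝ} (hval : ValidWeight u v ξ)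
    {l : Expo} (hl : l ∈ logSupport u v) : wt ξ l < 0 := by
  classical
  obtain ⟨j, ⟨r, hr, hc⟩ | ⟨r, hr, hc⟩⟩ := exists_mem_support_of_mem_logSupport hl
  · exact wt_neg_of_mem_support_pow ξ (u j) (hval.1 j) r hr l (mem_support_iff.2 hc)
  · exact wt_neg_of_mem_support_pow ξ (v j) (hval.2 j) r hr l (mem_support_iff.2 hc)

/-- Archimedes: `N · x < c` for all large `N` when `x < 0`. [folklore] -/
theorem eventually_natMul_lt {x : ℝ} (hx : x < 0) (c : ℝ) : ∀ᶠ N : ℕ in Filter.atTop, (N : ℝ) * x < c := by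
  obtain ⟨N₀, hN₀⟩ := exists_nat_gt (c / x)
  refine Filter.eventually_atTop.2 ⟨N₀, fun N hN => ?_⟩
  have hN' : c / x < (N : ℝ) := hN₀.trans_le (by exact_mod_cast hN)
  have := mul_lt_mul_of_neg_right hN' hx
  rwa [div_mul_cancel₀ _ hx.ne] at this

open Classical in
/-- **Cap manufacture** (dilation + shallow common digit padding): a cell family `S ≠ ∅` is transported, with the same cardinality, to a cell
family of a normalised `t`-sparse pair on `m + g` positions whose cap exceeds `2^{m+g}(t+2)^4`. [folklore] -/
theorem hugeCap_padding {t g Lg : ℕ} (ht : 2 ≤ t) (hL : t + 2 < 2 ^ (Lg + 1)) (hg : g = 3 * (m + 4 * (Lg + 1)))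
    (u v : Fin m → MvPolynomial (Fin 2) ℂ)
    (hu : ∀ j, coeff 0 (u j) = 0 ∧ (u j).support.card ≤ t) (hv : ∀ j, coeff 0 (v j) = 0 ∧ (v j).support.card ≤ t)
    (R : Expo → Expo → Prop) (S : Finset Expo) (hS : IsCellFamily u v R S) (hne : S.Nonempty) :
    ∃ (u' v' : Fin (m + g) → MvPolynomial (Fin 2) ℂ) (R' : Expo → Expo → Prop) (S' : Finset Expo),
      (∀ j, coeff 0 (u' j) = 0 ∧ (u' j).support.card ≤ t) ∧ (∀ j, coeff 0 (v' j) = 0 ∧ (v' j).support.card ≤ t) ∧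
      IsCellFamily u' v' R' S' ∧ S'.card = S.card ∧
      2 ^ (m + g) * (t + 2) ^ 4 <
        ((blockSet (fun j => (u' j).support ∪ (v' j).support) Finset.univ).filter fun n =>
          n ∉ logSupport u' v' ∧ ∃ l ∈ S', ∃ ξ : Fin 2 → ℝ, ValidWeight u' v' ξ ∧ IsStrictTop ξ (logSupport u' v') l ∧
            wt ξ l < wt ξ n).card := by
  have hT := tailSupport_nonempty_of_isCellFamily hS hne
  have hs0 := tailSum_ne_zero (fun j => (hu j).1) (fun j => (hv j).1) hT
  have hspos : 0 < (∑ f ∈ tailSupport u v, f) 0 + (∑ f ∈ tailSupport u v, f) 1 := by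
    obtain ⟨i, hi⟩ := Finsupp.ne_iff.mp hs0
    fin_cases i <;> simp only [Finsupp.coe_zero, Pi.zero_apply, Fin.zero_eta, Fin.isValue, Fin.mk_one] at hi <;> omega
  have hKth := cap_threshold (m := m) ht hL hg
  obtain ⟨l₀, hl₀⟩ := hne
  choose ξ hval htop hR using fun l : S => hS l.1 l.2
  have hsneg : ∀ l : S, wt (ξ l) (∑ f ∈ tailSupport u v, f) < 0 := fun l => wt_tailSum_neg (hval l) hT
  have hl₀neg : wt (ξ ⟨l₀, hl₀⟩) l₀ < 0 := wt_neg_of_mem_logSupport (hval _) (htop ⟨l₀, hl₀⟩).1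
  -- the dilation factor `N`
  have ev1 : ∀ p ∈ S.attach ×ˢ tailSupport u v, ∀ᶠ N : ℕ in Filter.atTop,
      (N : ℝ) * wt (ξ p.1) p.2 < (((t + 1) ^ g : ℕ) : ℝ) * wt (ξ p.1) (∑ f ∈ tailSupport u v, f) := by
    intro p hp
    rw [Finset.mem_product] at hp
    exact eventually_natMul_lt (wt_neg_of_mem_tailSupport (hval p.1) hp.2) _
  have ev2 : ∀ᶠ N : ℕ in Filter.atTop,
      (N : ℝ) * wt (ξ ⟨l₀, hl₀⟩) l₀ < (((t + 1) ^ g : ℕ) : ℝ) * wt (ξ ⟨l₀, hl₀⟩) (∑ f ∈ tailSupport u v, f) :=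
    eventually_natMul_lt hl₀neg _
  have ev3 : ∀ᶠ N : ℕ in Filter.atTop,
      (t + 1) ^ g * ((∑ f ∈ tailSupport u v, f) 0 + (∑ f ∈ tailSupport u v, f) 1) < N := Filter.eventually_gt_atTop _
  obtain ⟨N, hN1, hN2, hN3⟩ := (((Filter.eventually_all_finset _).2 ev1).and (ev2.and ev3)).exists
  have hNpos : 0 < N := by omega
  -- the digit factors
  obtain ⟨w, hw⟩ : ∃ w : Fin g → MvPolynomial (Fin 2) ℂ, w = fun j : Fin g =>
      ∑ e ∈ (Finset.Icc 1 t).image (fun d => (d * (t + 1) ^ (j : ℕ)) • ∑ f ∈ tailSupport u v, f), monomial e (1 : ℂ) :=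
    ⟨_, rfl⟩
  have hwn := digitFactor_norm (t := t) hs0 w hw
  have hwlet := digit_tailSupport (t := t) w hw
  have hwsupp : ∀ j, ∀ e ∈ (w j).support, ∃ k : ℕ, 1 ≤ k ∧ e = k • ∑ f ∈ tailSupport u v, f := by
    intro j e he
    subst hw
    rw [support_monomialSum, Finset.mem_image] at he
    obtain ⟨d, hd, rfl⟩ := he
    rw [Finset.mem_Icc] at hd
    exact ⟨_, Nat.one_le_iff_ne_zero.2 (Nat.mul_ne_zero (by omega) (pow_ne_zero _ (by omega))), rfl⟩
  have hvalw : ∀ l : S, ValidWeight w w (ξ l) := by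
    intro l
    refine ⟨fun j e he => ?_, fun j e he => ?_⟩ <;>
    · obtain ⟨k, hk, rfl⟩ := hwsupp j e he
      rw [wt_nsmul]
      have := hsneg l
      have hk' : (1 : ℝ) ≤ k := by exact_mod_cast hk
      nlinarith
  have hlog : logSupport (Fin.append (fun j => expand N (u j)) w) (Fin.append (fun j => expand N (v j)) w) =
      (fun e => N • e) '' logSupport u v := by
    rw [logSupport_append_common, logSupport_expand hNpos.ne' u v (fun j => (hu j).1) (fun j => (hv j).1)]
  refine ⟨Fin.append (fun j => expand N (u j)) w, Fin.append (fun j => expand N (v j)) w,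
    fun e e' =>
      (e' ∈ tailSupport (fun j => expand N (u j)) (fun j => expand N (v j)) →
        e ∈ tailSupport (fun j => expand N (u j)) (fun j => expand N (v j)) ∧
          R (Finsupp.mapRange (fun k : ℕ => k / N) (by simp) e) (Finsupp.mapRange (fun k : ℕ => k / N) (by simp) e')) ∧
      (e' ∉ tailSupport (fun j => expand N (u j)) (fun j => expand N (v j)) →
        e ∈ tailSupport (fun j => expand N (u j)) (fun j => expand N (v j)) ∨ (e' 0 + e' 1 ≤ e 0 + e 1)),
    S.image (fun e => N • e),
    norm_append _ w (norm_expand hNpos.ne' u hu) hwn, norm_append _ w (norm_expand hNpos.ne' v hv) hwn,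
    ?_, card_image_nsmul hNpos S, ?_⟩
  · -- the padded family is a cell family: new letters above, ordered by their multiple of `s`
    apply isCellFamily_append_common_above
    intro l' hl'
    obtain ⟨l, hl, rfl⟩ := Finset.mem_image.1 hl'
    obtain ⟨hv1, ht1, hR1⟩ :=
      cellWitness_expand hNpos u v (fun j => (hu j).1) (fun j => (hv j).1) R (hval ⟨l, hl⟩) (htop ⟨l, hl⟩) (hR ⟨l, hl⟩)
    refine ⟨ξ ⟨l, hl⟩, hv1, hvalw ⟨l, hl⟩, ht1, hR1, ?_, ?_⟩
    · intro e he e' he'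
      rw [tailSupport_expand hNpos.ne', Finset.mem_image] at he
      obtain ⟨e₀, he₀, rfl⟩ := he
      obtain ⟨k, hk1, hkK, rfl⟩ := hwlet e' he'
      rw [wt_nsmul, wt_nsmul]
      have h1 := hN1 (⟨l, hl⟩, e₀) (Finset.mem_product.2 ⟨Finset.mem_attach _ _, he₀⟩)
      have h2 : (((t + 1) ^ g : ℕ) : ℝ) * wt (ξ ⟨l, hl⟩) (∑ f ∈ tailSupport u v, f) ≤
          (k : ℝ) * wt (ξ ⟨l, hl⟩) (∑ f ∈ tailSupport u v, f) :=
        mul_le_mul_of_nonpos_right (by exact_mod_cast hkK.le) (hsneg ⟨l, hl⟩).le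
      exact h1.trans_le h2
    · intro e he e' he'
      obtain ⟨k, -, -, rfl⟩ := hwlet e he
      obtain ⟨k', -, -, rfl⟩ := hwlet e' he'
      rw [wt_nsmul_tailSum_le_iff (hval ⟨l, hl⟩) hT]
      simp only [Finsupp.smul_apply, smul_eq_mul]
      constructor
      · intro h
        by_contra hlt
        push Not at hlt
        have := Nat.mul_le_mul_right ((∑ f ∈ tailSupport u v, f) 0 + (∑ f ∈ tailSupport u v, f) 1) hlt
        nlinarith
      · intro h
        nlinarith [Nat.mul_le_mul_right ((∑ f ∈ tailSupport u v, f) 0) h,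
          Nat.mul_le_mul_right ((∑ f ∈ tailSupport u v, f) 1) h]
  · -- the cap: all `k • s`, `1 ≤ k < (t+1)^g`, are cancelled tuple sums above the line of `N • l₀`
    refine lt_of_lt_of_le (by omega) (digit_cap_card hs0 ((t + 1) ^ g) _ (fun k hk1 hkK => ?_))
    rw [Finset.mem_filter]
    refine ⟨?_, ?_, N • l₀, Finset.mem_image_of_mem _ hl₀, ξ ⟨l₀, hl₀⟩, ?_, ?_, ?_⟩
    · apply digit_nsmul_mem_blockSet _ _ k hkK
      intro j d hd1 hdt
      simp only [Fin.append_right]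
      exact Finset.mem_union_left _ (digit_mem_support w hw j hd1 hdt)
    · rw [hlog]
      rintro ⟨x, -, hx⟩
      have h0 := DFunLike.congr_fun hx 0
      have h1 := DFunLike.congr_fun hx 1
      simp only [Finsupp.smul_apply, smul_eq_mul] at h0 h1
      have hks : k * ((∑ f ∈ tailSupport u v, f) 0 + (∑ f ∈ tailSupport u v, f) 1) < N :=
        lt_of_le_of_lt (Nat.mul_le_mul_right _ hkK.le) hN3
      rcases Nat.eq_zero_or_pos (x 0) with hx0 | hx0
      · rcases Nat.eq_zero_or_pos (x 1) with hx1 | hx1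
        · rw [hx0, mul_zero] at h0
          rw [hx1, mul_zero] at h1
          nlinarith
        · nlinarith [Nat.mul_le_mul_left N hx1]
      · nlinarith [Nat.mul_le_mul_left N hx0]
    · exact (validWeight_append_iff _ _ w w _).2 ⟨(validWeight_expand_iff hNpos u v _).2 (hval _), hvalw _⟩
    · rw [hlog]
      exact (isStrictTop_nsmul_iff hNpos _ _ l₀).2 (htop ⟨l₀, hl₀⟩)
    · rw [wt_nsmul, wt_nsmul]
      have h2 : (((t + 1) ^ g : ℕ) : ℝ) * wt (ξ ⟨l₀, hl₀⟩) (∑ f ∈ tailSupport u v, f) ≤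
          (k : ℝ) * wt (ξ ⟨l₀, hl₀⟩) (∑ f ∈ tailSupport u v, f) :=
        mul_le_mul_of_nonpos_right (by exact_mod_cast hkK.le) (hsneg ⟨l₀, hl₀⟩).le
      exact hN2.trans_le h2

open Classical in
/-- **`HugeCapCellLaw ⇒ PlanarCellBound`** (val-idea-34's cap-threshold sub-law, text verbatim, implies the full per-cell law; exponents
`(a, b) ↦ (4a, b + 24a)`). [folklore] -/
theorem planarCellBound_of_hugeCap
    (h : ∃ a b : ℕ, ∀ (m t : ℕ), 2 ≤ t → ∀ (u v : Fin m → MvPolynomial (Fin 2) ℂ),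
      (∀ j, coeff 0 (u j) = 0 ∧ (u j).support.card ≤ t) → (∀ j, coeff 0 (v j) = 0 ∧ (v j).support.card ≤ t) →
      ∀ (R : Expo → Expo → Prop) (S : Finset Expo), IsCellFamily u v R S →
      (2 ^ m * (t + 2) ^ 4 <
        ((blockSet (fun j => (u j).support ∪ (v j).support) Finset.univ).filter fun n =>
          n ∉ logSupport u v ∧ ∃ l ∈ S, ∃ ξ : Fin 2 → ℝ, ValidWeight u v ξ ∧ IsStrictTop ξ (logSupport u v) l ∧
            wt ξ l < wt ξ n).card) →
      S.card ≤ 2 ^ (a * m) * (t + 2) ^ b) :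
    ∃ a b : ℕ, ∀ (m t : ℕ), 2 ≤ t → ∀ (u v : Fin m → MvPolynomial (Fin 2) ℂ),
      (∀ j, coeff 0 (u j) = 0 ∧ (u j).support.card ≤ t) → (∀ j, coeff 0 (v j) = 0 ∧ (v j).support.card ≤ t) →
      ∀ (R : Expo → Expo → Prop) (S : Finset Expo),
        (∀ l ∈ S, ∃ ξ : Fin 2 → ℝ, ValidWeight u v ξ ∧ IsStrictTop ξ (logSupport u v) l ∧
          ∀ e ∈ ((Finset.univ.biUnion fun j => (u j).support) ∪ Finset.univ.biUnion fun j => (v j).support),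
          ∀ e' ∈ ((Finset.univ.biUnion fun j => (u j).support) ∪ Finset.univ.biUnion fun j => (v j).support),
            (R e e' ↔ wt ξ e ≤ wt ξ e')) →
        S.card ≤ 2 ^ (a * m) * (t + 2) ^ b := by
  obtain ⟨a, b, h⟩ := h
  refine ⟨4 * a, b + 24 * a, fun m t ht u v hu hv R S hS => ?_⟩
  change IsCellFamily u v R S at hS
  rcases S.eq_empty_or_nonempty with rfl | hne
  · simp
  obtain ⟨Lg, hLdef⟩ : ∃ Lg, Lg = Nat.log 2 (t + 2) := ⟨_, rfl⟩
  obtain ⟨g, hg⟩ : ∃ g, g = 3 * (m + 4 * (Lg + 1)) := ⟨_, rfl⟩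
  have hlt : t + 2 < 2 ^ (Lg + 1) := by rw [hLdef]; exact Nat.lt_pow_succ_log_self (by norm_num) _
  have hle : 2 ^ Lg ≤ t + 2 := by rw [hLdef]; exact Nat.pow_log_le_self 2 (by omega)
  obtain ⟨u', v', R', S', hu', hv', hS', hcard, hcap⟩ := hugeCap_padding ht hlt hg u v hu hv R S hS hne
  have := h (m + g) t ht u' v' hu' hv' R' S' hS' hcap
  rw [hcard] at this
  exact this.trans (cap_cost a b hle hg)

open Classical in
/-- **`HugeCapCellLaw ⇔ PlanarCellBound`** as `∃ a b` laws: the cap-threshold hypothesis is inert. [folklore] -/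
theorem hugeCap_iff_planarCellBound :
    (∃ a b : ℕ, ∀ (m t : ℕ), 2 ≤ t → ∀ (u v : Fin m → MvPolynomial (Fin 2) ℂ),
      (∀ j, coeff 0 (u j) = 0 ∧ (u j).support.card ≤ t) → (∀ j, coeff 0 (v j) = 0 ∧ (v j).support.card ≤ t) →
      ∀ (R : Expo → Expo → Prop) (S : Finset Expo), IsCellFamily u v R S →
      (2 ^ m * (t + 2) ^ 4 <
        ((blockSet (fun j => (u j).support ∪ (v j).support) Finset.univ).filter fun n =>
          n ∉ logSupport u v ∧ ∃ l ∈ S, ∃ ξ : Fin 2 → ℝ, ValidWeight u v ξ ∧ IsStrictTop ξ (logSupport u v) l ∧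
            wt ξ l < wt ξ n).card) →
      S.card ≤ 2 ^ (a * m) * (t + 2) ^ b) ↔
    ∃ a b : ℕ, ∀ (m t : ℕ), 2 ≤ t → ∀ (u v : Fin m → MvPolynomial (Fin 2) ℂ),
      (∀ j, coeff 0 (u j) = 0 ∧ (u j).support.card ≤ t) → (∀ j, coeff 0 (v j) = 0 ∧ (v j).support.card ≤ t) →
      ∀ (R : Expo → Expo → Prop) (S : Finset Expo),
        (∀ l ∈ S, ∃ ξ : Fin 2 → ℝ, ValidWeight u v ξ ∧ IsStrictTop ξ (logSupport u v) l ∧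
          ∀ e ∈ ((Finset.univ.biUnion fun j => (u j).support) ∪ Finset.univ.biUnion fun j => (v j).support),
          ∀ e' ∈ ((Finset.univ.biUnion fun j => (u j).support) ∪ Finset.univ.biUnion fun j => (v j).support),
            (R e e' ↔ wt ξ e ≤ wt ξ e')) →
        S.card ≤ 2 ^ (a * m) * (t + 2) ^ b := by
  refine ⟨planarCellBound_of_hugeCap, fun ⟨a, b, h⟩ => ⟨a, b, fun m t ht u v hu hv R S hS _ => ?_⟩⟩
  exact h m t ht u v hu hv R S hS

end Summit.ValiantsHypothesis.Theorems.TwoProducts.Negative.HugeCapResidual
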